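/-
Copyright: cell `pub-ymgap` (HUMAN RULING D-0062), Track A of `YM-PLAN.md`, DAG node N20 (= NE7b); R134 acceleration seat
`pub-ymgap-dag-n20-c` (strategy s1, generation 5), module 32.  Released under the licence of the surrounding project.
-/
import Summits.QuantumFields.YangMills.Theorems.BalabanUVNodesN20LCSLabelTowerPinnedLevel
import HarnessLib

/-!
# YM-DAG node N20 (= NE7b), strategy s1, module 32: THE TWO NAMED PROPS OF THE (α)-ROAD ALONG A LABEL PATTERN PINNED AT ANY FINITE SET OF LEVELS `J`,
# ON THE LABEL TOWER OF RECORD — `PointwiseExtraction` UNCONDITIONALLY, `LocCondStability` FROM EXACTLY «LCS-j» (moment form) AT THE PINNED LEVELS —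
# and the class weight bound with ONE PEIERLS FACTOR PER PINNED CUBE PER PINNED LEVEL

Track A of `YM-PLAN.md` (cell `pub-ymgap`, HUMAN RULING D-0062), node **N20** = spine estimate NE7b (`T4WeightBudget.RelWeightBound` — NOT PRINTED,
NOT PROVED).  Seat `pub-ymgap-dag-n20-c` (R134, s1 «the `LocCondStability` INSTANCE for Bałaban's tower at a pinned 𝐑𝐓 step»), generation 5, module 32
(27 = the label tower of record · 28 = keys rooted at step 0 · 29 = by-value junction · 30 = one later pinned level ⇐ «LCS-k» · 31 = support semantics).
Kernel theorems only: 0 `def`, 0 `sorry`, standard axioms; COUNT-NEUTRAL; `--supports` the K3⁗ item.  Nothing of Bałaban's is asserted.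

WHY.  The (α)-road's record (`Support/B16HistoryTowerExtractionStepDataLWR`: fields `pwA` ∕ `lcsA`) asks, per bad key, for the two named `Prop`s of
`Spine/NE7b/LocalConditionalStability` ALONG THE KEY's PATTERN — a pattern that pins events at SEVERAL levels (a genealogy).  Modules 28 (level `0`) and 30
(one level `k`) are the two one-level cases.  THIS FILE is the general case for the (3.2)-pin reading: a label-family pattern `E` that pins, at every
level `j` of a finite set `J`, a family `D_j` of χ_{j+1}-cubes into the new large-field family (`t ∈ E j h → D_j ⊆ P(t)`), arbitrary elsewhere.

WHAT.
* §1 ★★ `setIntegral_event_eterm_le_of_LCS` — THE `LocCondStability` CONJUNCT AT A PINNED LEVEL `k` FROM «LCS-k»: for a history `h` of length `k < K`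
  whose term's state under `μ_k` has local exponential plaquette moments (module 22's `hLS` shape), the `μ_k`-mass of the history term on the coarse
  large-field event `{U | ∀ □ ∈ D, ∃ p′ ∈ R □, ε″ ≤ |Ū(∂p′) − 1|}` is at most `(m·r_k)^{#D}` times its total mass (`r_k` module 22's rate) — module 22 §1 at
  the Haar state `(dμ_k∕dHaar_k)·eterm` (module 30's transport), size event ⊆ energy event (n20-d `sq_div_le_one_sub_reTr_of_le_dist1`).  No regularity
  letter here.  `sumAlong_blind` (bookkeeping).
* §2 ★★★ **`halves_labelTower_pinnedLevels`** — for a finite set of levels `J` (each `< K`), per-level cube families `D_j`, letter regions `R_j` (pairwise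
  disjoint, `≤ m_j` plaquettes, regularity letters at `ε″_j ≥ 0`), per-level moment data (`α_j`, `β_j`, `C_j`, `a₀_j`, `δ_j` with module 22's guards), a cutoff
  `K′`, a pattern `E` pinning `D_j` at the levels `j ∈ J`, and «LCS-j» for the states of all pattern prefixes of every pinned length `j ∈ J`, `j < K′`:
  `PointwiseExtraction T (labelPattern E) K′ labelChi Mc 0 ∧ LocCondStability T (labelPattern E) K′ lawOfRecord ρ₀ Mc b` for `T = labelTowerOfRecord A₁ ζ`,
  carriers `Mc j h = 𝟙[event_j ∘ avg_j]` (`j ∈ J`), `1` (else), exponents `a ≡ 0`, `b j h = log rate_j` (`j ∈ J`), `0` (else), `rate_j = (m_j·r_j)^{#D_j}`.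
* §3 ★★★ **`sum_admS_integral_le_labelTower_pinnedLevels`** — the class weight bound: `Σ_{h ∈ admS T (labelPattern E) K′} ∫ eterm ρ₀ K′ h dμ_{K′} ≤
  (Π_{j < K′, j ∈ J} rate_j) · ∫ ρ₀ dU₀` (`hrel_of_LCS` + `PrefixExtraction.sum_admS_integral_le`), and `lcs_zero_labelTower_of_record`: at level `0` with
  `ρ₀ = rhoZeroOfRecord`, `β₀ = g₀⁻² ≥ 4N`, «LCS-0» IS g2's theorem `N20LCSAtRecordLevelZero.lcs_rhoZeroOfRecord` (`a₀ = 1∕12`) — so for `J ∋ 0` only the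
  levels `j ≥ 1` carry a hypothesis; `sum_admS_integral_free_eq` (sanity: with no pinned level the class is the whole and the bound is attained).

HONEST FRAMING.  The displayed analytic hypotheses are «LCS-j» for `j ∈ J`, `j ≥ 1` (module 22's `hLS` shape, for the history-term states — print's KIND,
[Balaban1989LargeFieldI] (0.3)–(0.5), [Balaban1989LargeFieldII] p. 383 l. 21–28, NOT print's statement, NOT proved: the (A1c) residual), the two ζ-laws, the
(O4) measurability, the per-cube regularity letters ([Balaban1985Variational] Thm 1, NOT asserted), disjoint letter regions per level.  The pointwise half is
INLINED (n20-d g6's announced `sum_labelChi_pinned_le_indicator` is theirs to declare).  Conditional-expectation currency (module 27).  NE7b NOT PRINTED ∕ NOT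
PROVED; (α)-instance 0∕1; N20 NOT discharged; typed 28∕28, discharged count untouched; one finite four-torus at fixed `ε` — NOT ℝ⁴, NOT infinite volume, NOT
OS, NOT a mass gap, NOT Clay.

References (LOCATORS): T. Bałaban, CMP 119 (1988) 243–285 [Balaban1988Convergent] ((3.2)–(3.5) p. 265); CMP 122 (1989) 175–202 [Balaban1989LargeFieldI]
((0.1) p. 175, (0.3)–(0.5) pp. 176–177, (1.22)–(1.28) pp. 181–183); CMP 122 (1989) 355–392 [Balaban1989LargeFieldII] ((1.79)–(1.80) pp. 383–384);
CMP 102 (1985) 277–309 [Balaban1985Variational] (Thm 1 p. 279).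
-/

set_option autoImplicit false

noncomputable section

open scoped BigOperators ENNReal

namespace Summit.QuantumFields.YangMills.BalabanUVNodes.N20LCSLabelTowerPinnedLevels

open MeasureTheory
open Literature.MathematicalPhysics.QuantumFieldTheory.Balaban1983to89
open Literature.MathematicalPhysics.QuantumFieldTheory.Balaban1983to89.T4Continuum
open Literature.MathematicalPhysics.QuantumFieldTheory.Balaban1983to89.Node00
open Summit.QuantumFields.BalabanUV.T4Continuum.B16HistoryIndexedRepr (GoodClass)
open Summit.QuantumFields.BalabanUV.T4Continuum.B16HistoryReprChain
open Summit.QuantumFields.BalabanUV.T4Continuum.NE7b.PrefixExtraction (admS admS_subset_adm admS_eq_adm_of_forall sum_admS_integral_le)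
open Summit.QuantumFields.BalabanUV.T4Continuum.NE7b.LocalConditionalStability (LocCondStability PointwiseExtraction sumAlong hrel_of_LCS)
open Summit.QuantumFields.YangMills.BalabanUVNodes.N20LCSLabelTower
open Summit.QuantumFields.YangMills.BalabanUVNodes.N20LCSLabelTowerClassWeight (labelChi_eq)
open Summit.QuantumFields.YangMills.BalabanUVNodes.N20LCSLabelTowerPinnedLevel
  (lawOfRecord_absolutelyContinuous integral_lawOfRecord_eq measurable_rnDeriv_toReal integrable_rnDeriv_mul)
open Summit.QuantumFields.YangMills.BalabanUVNodes.N20LCSLargeFieldFamilies (measurableSet_forall_exists_largeField)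
open Summit.QuantumFields.YangMills.BalabanUVNodes.N20LCSLargeFieldOfMoments (setIntegral_forall_exists_le_of_moments)
open Summit.QuantumFields.YangMills.BalabanUVNodes.N20LCSLargeFieldSubfamilies (abs_sum_ωOfRecord_sub_le_indicator sum_ωOfRecord_sub_le)
open Summit.QuantumFields.YangMills.BalabanUVNodes.N20LCSLargeFieldSparsify (zeta_nonneg_of_laws)
open Summit.QuantumFields.YangMills.BalabanUVNodes.N20LCSAvgExpMoment (sq_div_le_one_sub_reTr_of_le_dist1)
open Summit.QuantumFields.YangMills.BalabanUVNodes.N20LCSAtRecordLevelZero (lcs_rhoZeroOfRecord)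
open ExpMeanLog (expMeanLogSU deltaSU)
open BlockAveraging (avgFun)

variable (F : T4Family) (N : ℕ) [NeZero N] (ν : Stage7Numerics) (M : ℕ) (p : B12.RunParams) (g : ℕ → ℝ)

/-! ## §1 The `LocCondStability` conjunct at a pinned level from «LCS-k» -/

section Pinned

variable {A₁ : ℝ} {ζ : ZetaOfRecord F N ν M}

/-- Along every history a HISTORY-BLIND exponent family sums to the plain sum over the levels. [folklore] -/
theorem sumAlong_blind {Pat : Type} (f : ℕ → ℝ) : ∀ (K : ℕ) (h : Fin K → Pat), sumAlong (fun j (_ : Fin j → Pat) => f j) K h = ∑ j ∈ Finset.range K, f j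
  | 0, _ => by simp [sumAlong]
  | K + 1, h => by
      show sumAlong (fun j (_ : Fin j → Pat) => f j) K (Fin.init h) + f K = _
      rw [sumAlong_blind f K (Fin.init h), Finset.sum_range_succ]

/-- ★★ **THE `μ_k`-MASS OF A HISTORY TERM ON THE COARSE LARGE-FIELD EVENT, FROM «LCS-k».**  For `k < K`, `α > 0` in the transfer guard, a bounded measurable
`ρ₀ ≥ 0`, a history `h` of length `k` whose term's state under `μ_k` has local exponential plaquette moments (`∀ 0 ≤ a ≤ a₀, ∀ X,
∫ e^{aβΣ_{q∈X}(1 − Re tr U(∂q))}·eterm dμ_k ≤ e^{Ca#X}·∫ eterm dμ_k`), a window `δ` with module 22's condition, a finite family `D` of cells with pairwise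
disjoint regions `R □` of `≤ m` plaquettes and `ε″ ≥ 0`:
`∫_{∀ □ ∈ D, ∃ p′ ∈ R □, ε″ ≤ |Ū(∂p′) − 1|} eterm ρ₀ k h dμ_k ≤ (m·r_k)^{#D} · ∫ eterm ρ₀ k h dμ_k` — module 22 §1 at the Haar state `(dμ_k∕dHaar_k)·eterm`,
the size event inside the energy event at threshold `ε″²∕(2N)`. [folklore] -/
theorem setIntegral_event_eterm_le_of_LCS (k : ℕ) (hk : k < p.K) {α : ℝ} (hα : 0 < α)
    (hguard : (((((F.P p.K).d + 2) * (F.P p.K).L : ℕ) : ℝ) ^ 2 / 4) * Real.sqrt (2 * (Fintype.card (Fin N) : ℝ) * α) <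
      deltaSU (Fin N))
    {ρ₀ : cfgOfRecord F N p.K 0 → ℝ} (hρ : (bddMeas (cfgOfRecord F N p.K 0)).Gd ρ₀) (h0 : ∀ U, 0 ≤ ρ₀ U)
    (h : Fin k → LabelPat F ν p g) {β : ℝ} (hβ : 0 ≤ β) {C a₀ : ℝ} (hC : 0 ≤ C)
    (hLS : ∀ a : ℝ, 0 ≤ a → a ≤ a₀ → ∀ X : Finset (Plaq (F.P p.K) k),
      ∫ U, Real.exp (a * β * ∑ q ∈ X, (1 - reTr (GaugeField.plaqHol U q))) *
          (labelTowerOfRecord F N ν M p g A₁ ζ).eterm ρ₀ k h U ∂(lawOfRecord F N p.K k) ≤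
        Real.exp (C * a * X.card) * ∫ U, (labelTowerOfRecord F N ν M p g A₁ ζ).eterm ρ₀ k h U ∂(lawOfRecord F N p.K k))
    {δ : ℝ} (hδ0 : 0 ≤ δ)
    (hδ : δ * ((2 * (Fintype.card (Fin N) : ℝ) * (((F.P p.K).L : ℝ) ^ 2 + 6 * ((((F.P p.K).d + 2) * (F.P p.K).L : ℕ) : ℝ) ^ 2) ^ 2 + 2 / α) *
      (((2 * (((F.P p.K).d + 3) * (F.P p.K).L + 2) + 1) ^ (F.P p.K).d * (F.P p.K).d ^ 2 : ℕ) : ℝ)) ≤ a₀)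
    (D : Finset (Iχ F ν p g k)) (R : Iχ F ν p g k → Finset (Plaq (F.P p.K) (k + 1))) (m : ℕ) {ε'' : ℝ} (hε : 0 ≤ ε'')
    (hm : ∀ c ∈ D, (R c).card ≤ m) (hdisj : ∀ c₁ ∈ D, ∀ c₂ ∈ D, c₁ ≠ c₂ → Disjoint (R c₁) (R c₂)) :
    ∫ U in {U | ∀ c ∈ D, ∃ p' ∈ R c, ε'' ≤ dist1 (GaugeField.plaqHol ((avOfRecord F N p.K k).avg U) p')},
        (labelTowerOfRecord F N ν M p g A₁ ζ).eterm ρ₀ k h U ∂(lawOfRecord F N p.K k) ≤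
      ((m : ℝ) * Real.exp (C * ((2 * (Fintype.card (Fin N) : ℝ) *
            (((F.P p.K).L : ℝ) ^ 2 + 6 * ((((F.P p.K).d + 2) * (F.P p.K).L : ℕ) : ℝ) ^ 2) ^ 2 + 2 / α) *
          (((2 * (((F.P p.K).d + 3) * (F.P p.K).L + 2) + 1) ^ (F.P p.K).d * (F.P p.K).d ^ 2 : ℕ) : ℝ)) *
          (((2 * (((F.P p.K).d + 3) * (F.P p.K).L + 2) + 1) ^ (F.P p.K).d * (F.P p.K).d ^ 2 : ℕ) : ℝ) * δ -
            δ * β * (ε'' ^ 2 / (2 * (Fintype.card (Fin N) : ℝ))))) ^ D.card *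
        ∫ U, (labelTowerOfRecord F N ν M p g A₁ ζ).eterm ρ₀ k h U ∂(lawOfRecord F N p.K k) := by
  classical
  set T := labelTowerOfRecord F N ν M p g A₁ ζ with hT
  set e : cfgOfRecord F N p.K k → ℝ := T.eterm ρ₀ k h with he
  set dens : cfgOfRecord F N p.K k → ℝ := fun U => ((lawOfRecord F N p.K k).rnDeriv (fieldMeasure (F.P p.K) k (SU N)) U).toReal
    with hdens
  have hk' : k ≤ p.K := hk.le
  have hj : k + 1 ≤ (F.P p.K).m + (F.P p.K).K := by
    simp only [T4Family.P_m, T4Family.P_K]; omega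
  have hegood : (bddMeas (cfgOfRecord F N p.K k)).Gd e := T.eterm_good hρ k h
  have he0 : ∀ U, 0 ≤ e U := fun U => T.eterm_nonneg hρ h0 k h U
  have heint : Integrable e (lawOfRecord F N p.K k) := integrable_of_bddMeas _ hegood
  have hfm : Measurable fun U => dens U * e U := (measurable_rnDeriv_toReal F N p.K k).mul hegood.1
  have hf0 : ∀ U, 0 ≤ dens U * e U := fun U => mul_nonneg ENNReal.toReal_nonneg (he0 U)
  have hfi : Integrable (fun U => dens U * e U) (fieldMeasure (F.P p.K) k (SU N)) := integrable_rnDeriv_mul F N p.K k hk' heint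
  -- «LCS-k» transported to the Haar state
  have hLS' : ∀ a : ℝ, 0 ≤ a → a ≤ a₀ → ∀ X : Finset (Plaq (F.P p.K) k),
      ∫ U, Real.exp (a * β * ∑ q ∈ X, (1 - reTr (GaugeField.plaqHol U q))) * (dens U * e U) ∂(fieldMeasure (F.P p.K) k (SU N)) ≤
        Real.exp (C * a * X.card) * ∫ U, dens U * e U ∂(fieldMeasure (F.P p.K) k (SU N)) := by
    intro a ha ha0 X
    have e1 : ∫ U, Real.exp (a * β * ∑ q ∈ X, (1 - reTr (GaugeField.plaqHol U q))) * (dens U * e U) ∂(fieldMeasure (F.P p.K) k (SU N)) =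
        ∫ U, Real.exp (a * β * ∑ q ∈ X, (1 - reTr (GaugeField.plaqHol U q))) * e U ∂(lawOfRecord F N p.K k) := by
      rw [integral_lawOfRecord_eq F N p.K k hk']
      exact integral_congr_ae (ae_of_all _ fun U => by ring)
    rw [e1, ← integral_lawOfRecord_eq F N p.K k hk' e]
    exact hLS a ha ha0 X
  -- the size event and the energy event
  set S : Set (cfgOfRecord F N p.K k) :=
    {U | ∀ c ∈ D, ∃ p' ∈ R c, ε'' ≤ dist1 (GaugeField.plaqHol ((avOfRecord F N p.K k).avg U) p')} with hS
  set S' : Set (cfgOfRecord F N p.K k) :=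
    {U | ∀ c ∈ D, ∃ p' ∈ R c, ε'' ^ 2 / (2 * (Fintype.card (Fin N) : ℝ)) ≤
      1 - reTr (GaugeField.plaqHol (avgFun (expMeanLogSU (n := Fin N)) U) p')} with hS'
  have hsub : S ⊆ S' := by
    intro U hU c hc
    obtain ⟨p', hp', hle⟩ := hU c hc
    exact ⟨p', hp', sq_div_le_one_sub_reTr_of_le_dist1 _ hε hle⟩
  have hSm : MeasurableSet S :=
    (measurableSet_forall_exists_largeField F N ν p g k D R ε'').preimage (avOfRecord_measurable F N p.K k)
  -- `∫_S e dμ_k = ∫_S dens·e dHaar ≤ ∫_{S'} dens·e dHaar ≤ (m r)^{#D} ∫ dens·e dHaar = (m r)^{#D} ∫ e dμ_k`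
  have h1 : ∫ U in S, e U ∂(lawOfRecord F N p.K k) = ∫ U in S, dens U * e U ∂(fieldMeasure (F.P p.K) k (SU N)) := by
    rw [← integral_indicator hSm, ← integral_indicator hSm, integral_lawOfRecord_eq F N p.K k hk']
    refine integral_congr_ae (ae_of_all _ fun U => ?_)
    show dens U * S.indicator e U = S.indicator (fun U => dens U * e U) U
    rw [Set.indicator_mul_right]
  have h2 : ∫ U in S, dens U * e U ∂(fieldMeasure (F.P p.K) k (SU N)) ≤ ∫ U in S', dens U * e U ∂(fieldMeasure (F.P p.K) k (SU N)) :=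
    setIntegral_mono_set hfi.integrableOn (ae_of_all _ hf0) (ae_of_all _ hsub)
  have h3 := setIntegral_forall_exists_le_of_moments (N := N) hj hα hguard hfm hf0 hfi hβ hC hLS' hδ0 hδ
    (ε'' ^ 2 / (2 * (Fintype.card (Fin N) : ℝ))) D R m hm hdisj
  have h4 : ∫ U, dens U * e U ∂(fieldMeasure (F.P p.K) k (SU N)) = ∫ U, e U ∂(lawOfRecord F N p.K k) :=
    (integral_lawOfRecord_eq F N p.K k hk' e).symm
  rw [h1, ← h4]
  exact h2.trans h3

end Pinned

/-! ## §2 Both named Props along a pattern pinned at the levels of `J` -/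

section Halves

variable {A₁ : ℝ} {ζ : ZetaOfRecord F N ν M}

open Classical in
/-- ★★★ **`PointwiseExtraction ∧ LocCondStability` ALONG A LABEL PATTERN PINNED AT THE LEVELS OF `J`, ON BAŁABAN's LABEL TOWER OF RECORD.**  Data: a finite set
of levels `J`, all `< K`; per level `j`: a cube family `D j`, letter regions `R j` (pairwise disjoint over `D j`, `≤ m j` plaquettes) with regularity letters at
`ε″ j ≥ 0`, moment constants `α j > 0` (transfer guard), `β j ≥ 0`, `C j ≥ 0`, `a₀ j`, `δ j ≥ 0` (module 22's window), and the Peierls rate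
`rate j = (m j · r_j)^{#D j}` (`hrate`); the two ζ-laws (no (O4) measurability needed for the halves themselves); a bounded measurable `ρ₀ ≥ 0`; a cutoff `K′`; a label-family pattern
`E` pinning `D j` at every `j ∈ J` (`t ∈ E j h → D j ⊆ P(t)`); and «LCS-j» — local exponential plaquette moments of the states `eterm ρ₀ j h` under `μ_j` for
every pattern prefix `h` of every pinned length `j ∈ J`, `j < K′`.  Conclusion: both named `Prop`s of `Spine/NE7b/LocalConditionalStability` hold at cutoff
`K′` for `labelTowerOfRecord A₁ ζ` along `labelPattern E` with the step kernels `labelChi`, carriers `𝟙[∀ □ ∈ D j, ∃ p′ ∈ R j □, ε″ j ≤ |avg_j U(∂p′) − 1|]`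
at pinned levels (`1` elsewhere), extracted exponents `0`, stability exponents `log (rate j)` at pinned levels (`0` elsewhere). [folklore] -/
theorem halves_labelTower_pinnedLevels (hζu : IsZetaUnity F N ν M ζ) (hζ : IsZetaAbsLeOne F N ν M ζ)
    {ρ₀ : cfgOfRecord F N p.K 0 → ℝ} (hρ : (bddMeas (cfgOfRecord F N p.K 0)).Gd ρ₀) (h0 : ∀ U, 0 ≤ ρ₀ U)
    (J : Finset ℕ) (hJ : ∀ j ∈ J, j < p.K)
    (D : (j : ℕ) → Finset (Iχ F ν p g j)) (R : (j : ℕ) → Iχ F ν p g j → Finset (Plaq (F.P p.K) (j + 1))) (m : ℕ → ℕ) (ε'' : ℕ → ℝ)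
    (hε : ∀ j ∈ J, 0 ≤ ε'' j) (hm : ∀ j ∈ J, ∀ c ∈ D j, (R j c).card ≤ m j)
    (hdisj : ∀ j ∈ J, ∀ c₁ ∈ D j, ∀ c₂ ∈ D j, c₁ ≠ c₂ → Disjoint (R j c₁) (R j c₂))
    (hreg : ∀ j ∈ J, ∀ c ∈ D j, ∀ V' : GaugeField (F.P p.K) (j + 1) (SU N),
      (∀ p' ∈ R j c, dist1 (GaugeField.plaqHol V' p') < ε'' j) → chiFactor F N ν p g j c V' = 1)
    (α β C a₀ δ rate : ℕ → ℝ) (hα : ∀ j ∈ J, 0 < α j)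
    (hguard : ∀ j ∈ J, (((((F.P p.K).d + 2) * (F.P p.K).L : ℕ) : ℝ) ^ 2 / 4) * Real.sqrt (2 * (Fintype.card (Fin N) : ℝ) * α j) <
      deltaSU (Fin N))
    (hβ : ∀ j ∈ J, 0 ≤ β j) (hC : ∀ j ∈ J, 0 ≤ C j) (hδ0 : ∀ j ∈ J, 0 ≤ δ j)
    (hδ : ∀ j ∈ J, δ j * ((2 * (Fintype.card (Fin N) : ℝ) * (((F.P p.K).L : ℝ) ^ 2 + 6 * ((((F.P p.K).d + 2) * (F.P p.K).L : ℕ) : ℝ) ^ 2) ^ 2 +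
        2 / α j) * (((2 * (((F.P p.K).d + 3) * (F.P p.K).L + 2) + 1) ^ (F.P p.K).d * (F.P p.K).d ^ 2 : ℕ) : ℝ)) ≤ a₀ j)
    (hrate : ∀ j ∈ J, rate j = ((m j : ℝ) * Real.exp (C j * ((2 * (Fintype.card (Fin N) : ℝ) *
            (((F.P p.K).L : ℝ) ^ 2 + 6 * ((((F.P p.K).d + 2) * (F.P p.K).L : ℕ) : ℝ) ^ 2) ^ 2 + 2 / α j) *
          (((2 * (((F.P p.K).d + 3) * (F.P p.K).L + 2) + 1) ^ (F.P p.K).d * (F.P p.K).d ^ 2 : ℕ) : ℝ)) *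
          (((2 * (((F.P p.K).d + 3) * (F.P p.K).L + 2) + 1) ^ (F.P p.K).d * (F.P p.K).d ^ 2 : ℕ) : ℝ) * δ j -
            δ j * β j * (ε'' j ^ 2 / (2 * (Fintype.card (Fin N) : ℝ))))) ^ (D j).card)
    (hrate0 : ∀ j ∈ J, 0 < rate j)
    (K' : ℕ) (E : (j : ℕ) → (Fin j → LabelPat F ν p g) → Finset (LbOfRecord F ν p g j)) (hE : ∀ j ∈ J, ∀ h t, t ∈ E j h → D j ⊆ t.1)
    (hLS : ∀ j ∈ J, j < K' → ∀ h : Fin j → LabelPat F ν p g, h ∈ admS (labelTowerOfRecord F N ν M p g A₁ ζ) (labelPattern F ν p g E) j →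
      ∀ a : ℝ, 0 ≤ a → a ≤ a₀ j → ∀ X : Finset (Plaq (F.P p.K) j),
        ∫ U, Real.exp (a * β j * ∑ q ∈ X, (1 - reTr (GaugeField.plaqHol U q))) *
            (labelTowerOfRecord F N ν M p g A₁ ζ).eterm ρ₀ j h U ∂(lawOfRecord F N p.K j) ≤
          Real.exp (C j * a * X.card) * ∫ U, (labelTowerOfRecord F N ν M p g A₁ ζ).eterm ρ₀ j h U ∂(lawOfRecord F N p.K j)) :
    PointwiseExtraction (labelTowerOfRecord F N ν M p g A₁ ζ) (labelPattern F ν p g E) K' (labelChi F N ν M p g A₁ ζ)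
        (fun j _ U => if j ∈ J then Set.indicator {U : cfgOfRecord F N p.K j |
            ∀ c ∈ D j, ∃ p' ∈ R j c, ε'' j ≤ dist1 (GaugeField.plaqHol ((avOfRecord F N p.K j).avg U) p')} (fun _ => (1 : ℝ)) U else 1)
        (fun _ _ => 0) ∧
      LocCondStability (labelTowerOfRecord F N ν M p g A₁ ζ) (labelPattern F ν p g E) K' (lawOfRecord F N p.K) ρ₀
        (fun j _ U => if j ∈ J then Set.indicator {U : cfgOfRecord F N p.K j |
            ∀ c ∈ D j, ∃ p' ∈ R j c, ε'' j ≤ dist1 (GaugeField.plaqHol ((avOfRecord F N p.K j).avg U) p')} (fun _ => (1 : ℝ)) U else 1)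
        (fun j _ => if j ∈ J then Real.log (rate j) else 0) := by
  set T := labelTowerOfRecord F N ν M p g A₁ ζ with hT
  have hζ0 := zeta_nonneg_of_laws F N ν M hζu hζ
  refine ⟨?_, ?_⟩
  · -- half (i), pointwise, at every level
    intro j h hj _ U
    rw [neg_zero, Real.exp_zero, one_mul, branch_inter_labelPattern, sum_labelPattern,
      Finset.sum_congr rfl fun t _ => by rw [labelChi_eq F N ν M p g A₁ hζu hζ, labelAt_mk]]
    dsimp only
    by_cases hjJ : j ∈ J
    · rw [if_pos hjJ]
      have h1 := (le_abs_self _).trans (abs_sum_ωOfRecord_sub_le_indicator F N ν M p g j A₁ hζ hζ0 (seqOfHist F ν M p g j h) (D j) (E j h)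
        (hE j hjJ h) (R j) (ε'' j) (hreg j hjJ) U ((avOfRecord F N p.K j).avg U))
      refine h1.trans (le_of_eq ?_)
      by_cases hU : ∀ c ∈ D j, ∃ p' ∈ R j c, ε'' j ≤ dist1 (GaugeField.plaqHol ((avOfRecord F N p.K j).avg U) p')
      · rw [Set.indicator_of_mem (show (avOfRecord F N p.K j).avg U ∈ {V' : GaugeField (F.P p.K) (j + 1) (SU N) |
            ∀ c ∈ D j, ∃ p' ∈ R j c, ε'' j ≤ dist1 (GaugeField.plaqHol V' p')} from hU),
          Set.indicator_of_mem (show U ∈ {U : cfgOfRecord F N p.K j |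
            ∀ c ∈ D j, ∃ p' ∈ R j c, ε'' j ≤ dist1 (GaugeField.plaqHol ((avOfRecord F N p.K j).avg U) p')} from hU)]
      · rw [Set.indicator_of_notMem (show (avOfRecord F N p.K j).avg U ∉ {V' : GaugeField (F.P p.K) (j + 1) (SU N) |
            ∀ c ∈ D j, ∃ p' ∈ R j c, ε'' j ≤ dist1 (GaugeField.plaqHol V' p')} from hU),
          Set.indicator_of_notMem (show U ∉ {U : cfgOfRecord F N p.K j |
            ∀ c ∈ D j, ∃ p' ∈ R j c, ε'' j ≤ dist1 (GaugeField.plaqHol ((avOfRecord F N p.K j).avg U) p')} from hU)]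
    · rw [if_neg hjJ]
      have h1 := sum_ωOfRecord_sub_le F N ν M p g j A₁ hζ hζ0 (seqOfHist F ν M p g j h) ∅ (E j h) (fun _ _ => Finset.empty_subset _) U
        ((avOfRecord F N p.K j).avg U)
      simpa using h1.2
  · -- half (ii), at every level
    intro j h hj hadm
    have hegood : (bddMeas (cfgOfRecord F N p.K j)).Gd (T.eterm ρ₀ j h) := T.eterm_good hρ j h
    have he0 : ∀ U, 0 ≤ T.eterm ρ₀ j h U := fun U => T.eterm_nonneg hρ h0 j h U
    have heint : Integrable (T.eterm ρ₀ j h) (lawOfRecord F N p.K j) := integrable_of_bddMeas _ hegood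
    by_cases hjJ : j ∈ J
    · simp only [if_pos hjJ]
      set S : Set (cfgOfRecord F N p.K j) :=
        {U | ∀ c ∈ D j, ∃ p' ∈ R j c, ε'' j ≤ dist1 (GaugeField.plaqHol ((avOfRecord F N p.K j).avg U) p')} with hS
      have hSm : MeasurableSet S :=
        (measurableSet_forall_exists_largeField F N ν p g j (D j) (R j) (ε'' j)).preimage (avOfRecord_measurable F N p.K j)
      have hind : ∀ U, S.indicator (fun _ => (1 : ℝ)) U * T.eterm ρ₀ j h U = S.indicator (T.eterm ρ₀ j h) U := by
        intro U
        by_cases hU : U ∈ S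
        · simp only [Set.indicator_of_mem hU, one_mul]
        · simp only [Set.indicator_of_notMem hU, zero_mul]
      refine ⟨(heint.indicator hSm).congr (ae_of_all _ fun U => (hind U).symm), ?_⟩
      rw [integral_congr_ae (ae_of_all _ hind), integral_indicator hSm, Real.exp_log (hrate0 j hjJ), hrate j hjJ]
      exact setIntegral_event_eterm_le_of_LCS F N ν M p g j (hJ j hjJ) (hα j hjJ) (hguard j hjJ) hρ h0 h (hβ j hjJ) (hC j hjJ)
        (hLS j hjJ hj h hadm) (hδ0 j hjJ) (hδ j hjJ) (D j) (R j) (m j) (hε j hjJ) (hm j hjJ) (hdisj j hjJ)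
    · simp only [if_neg hjJ, one_mul, Real.exp_zero]
      exact ⟨heint, le_rfl⟩

end Halves

/-! ## §3 The class weight bound along a multi-level pinned pattern; «LCS-0» of record is a theorem -/

section ClassWeight

variable {A₁ : ℝ} {ζ : ZetaOfRecord F N ν M}

open Classical in
/-- ★★★ **THE CLASS WEIGHT BOUND FOR A PATTERN PINNED AT THE LEVELS OF `J`, ONE PEIERLS FACTOR PER PINNED CUBE PER PINNED LEVEL.**  With the data and
hypotheses of `halves_labelTower_pinnedLevels`:
`Σ_{h ∈ admS (labelTowerOfRecord A₁ ζ) (labelPattern E) K′} ∫ eterm ρ₀ K′ h dμ_{K′} ≤ (Π_{j < K′, j ∈ J} rate j) · ∫ ρ₀ dU₀`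
— `LocalConditionalStability.hrel_of_LCS` (module 27's `hstep` ∕ `hintχ` rows) and the prefix induction `PrefixExtraction.sum_admS_integral_le` with the rates
`rate j` at the pinned levels and `1` at the free ones. [folklore] -/
theorem sum_admS_integral_le_labelTower_pinnedLevels (hζu : IsZetaUnity F N ν M ζ) (hζ : IsZetaAbsLeOne F N ν M ζ)
    (hω : ∀ (k : ℕ) (s : SeqOfRecord F ν M g p.K k) (t : LbOfRecord F ν p g k),
      Measurable fun z : cfgOfRecord F N p.K (k + 1) × cfgOfRecord F N p.K k => ωOfRecord F N ν M p g k A₁ ζ s t z.2 z.1)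
    {ρ₀ : cfgOfRecord F N p.K 0 → ℝ} (hρ : (bddMeas (cfgOfRecord F N p.K 0)).Gd ρ₀) (h0 : ∀ U, 0 ≤ ρ₀ U)
    (J : Finset ℕ) (hJ : ∀ j ∈ J, j < p.K)
    (D : (j : ℕ) → Finset (Iχ F ν p g j)) (R : (j : ℕ) → Iχ F ν p g j → Finset (Plaq (F.P p.K) (j + 1))) (m : ℕ → ℕ) (ε'' : ℕ → ℝ)
    (hε : ∀ j ∈ J, 0 ≤ ε'' j) (hm : ∀ j ∈ J, ∀ c ∈ D j, (R j c).card ≤ m j)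
    (hdisj : ∀ j ∈ J, ∀ c₁ ∈ D j, ∀ c₂ ∈ D j, c₁ ≠ c₂ → Disjoint (R j c₁) (R j c₂))
    (hreg : ∀ j ∈ J, ∀ c ∈ D j, ∀ V' : GaugeField (F.P p.K) (j + 1) (SU N),
      (∀ p' ∈ R j c, dist1 (GaugeField.plaqHol V' p') < ε'' j) → chiFactor F N ν p g j c V' = 1)
    (α β C a₀ δ rate : ℕ → ℝ) (hα : ∀ j ∈ J, 0 < α j)
    (hguard : ∀ j ∈ J, (((((F.P p.K).d + 2) * (F.P p.K).L : ℕ) : ℝ) ^ 2 / 4) * Real.sqrt (2 * (Fintype.card (Fin N) : ℝ) * α j) <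
      deltaSU (Fin N))
    (hβ : ∀ j ∈ J, 0 ≤ β j) (hC : ∀ j ∈ J, 0 ≤ C j) (hδ0 : ∀ j ∈ J, 0 ≤ δ j)
    (hδ : ∀ j ∈ J, δ j * ((2 * (Fintype.card (Fin N) : ℝ) * (((F.P p.K).L : ℝ) ^ 2 + 6 * ((((F.P p.K).d + 2) * (F.P p.K).L : ℕ) : ℝ) ^ 2) ^ 2 +
        2 / α j) * (((2 * (((F.P p.K).d + 3) * (F.P p.K).L + 2) + 1) ^ (F.P p.K).d * (F.P p.K).d ^ 2 : ℕ) : ℝ)) ≤ a₀ j)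
    (hrate : ∀ j ∈ J, rate j = ((m j : ℝ) * Real.exp (C j * ((2 * (Fintype.card (Fin N) : ℝ) *
            (((F.P p.K).L : ℝ) ^ 2 + 6 * ((((F.P p.K).d + 2) * (F.P p.K).L : ℕ) : ℝ) ^ 2) ^ 2 + 2 / α j) *
          (((2 * (((F.P p.K).d + 3) * (F.P p.K).L + 2) + 1) ^ (F.P p.K).d * (F.P p.K).d ^ 2 : ℕ) : ℝ)) *
          (((2 * (((F.P p.K).d + 3) * (F.P p.K).L + 2) + 1) ^ (F.P p.K).d * (F.P p.K).d ^ 2 : ℕ) : ℝ) * δ j -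
            δ j * β j * (ε'' j ^ 2 / (2 * (Fintype.card (Fin N) : ℝ))))) ^ (D j).card)
    (hrate0 : ∀ j ∈ J, 0 < rate j)
    (K' : ℕ) (E : (j : ℕ) → (Fin j → LabelPat F ν p g) → Finset (LbOfRecord F ν p g j)) (hE : ∀ j ∈ J, ∀ h t, t ∈ E j h → D j ⊆ t.1)
    (hLS : ∀ j ∈ J, j < K' → ∀ h : Fin j → LabelPat F ν p g, h ∈ admS (labelTowerOfRecord F N ν M p g A₁ ζ) (labelPattern F ν p g E) j →
      ∀ a : ℝ, 0 ≤ a → a ≤ a₀ j → ∀ X : Finset (Plaq (F.P p.K) j),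
        ∫ U, Real.exp (a * β j * ∑ q ∈ X, (1 - reTr (GaugeField.plaqHol U q))) *
            (labelTowerOfRecord F N ν M p g A₁ ζ).eterm ρ₀ j h U ∂(lawOfRecord F N p.K j) ≤
          Real.exp (C j * a * X.card) * ∫ U, (labelTowerOfRecord F N ν M p g A₁ ζ).eterm ρ₀ j h U ∂(lawOfRecord F N p.K j)) :
    ∑ h ∈ admS (labelTowerOfRecord F N ν M p g A₁ ζ) (labelPattern F ν p g E) K',
        ∫ x, (labelTowerOfRecord F N ν M p g A₁ ζ).eterm ρ₀ K' h x ∂(lawOfRecord F N p.K K') ≤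
      (∏ j ∈ (Finset.range K').filter (· ∈ J), rate j) * ∫ U, ρ₀ U ∂(fieldMeasure (F.P p.K) 0 (SU N)) := by
  set T := labelTowerOfRecord F N ν M p g A₁ ζ with hT
  obtain ⟨hPE, hLCS⟩ := halves_labelTower_pinnedLevels F N ν M p g hζu hζ hρ h0 J hJ D R m ε'' hε hm hdisj hreg α β C a₀ δ rate hα
    hguard hβ hC hδ0 hδ hrate hrate0 K' E hE hLS
  -- `hrel` at every pattern prefix with rate `e^{b − 0}`
  have hrel := hrel_of_LCS (T := T) (S := labelPattern F ν p g E) (μ := lawOfRecord F N p.K) (K := K') hρ h0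
    (fun j h _ _ q _ f hf => hstep_labelTower F N ν M p g hω j h q f hf)
    (fun j h _ _ q _ => integrable_labelChi_mul_eterm F N ν M p g hω hρ j h q) hPE hLCS
  -- the rate family, history-blind
  have key := sum_admS_integral_le T (labelPattern F ν p g E) (lawOfRecord F N p.K) ρ₀ (fun j => if j ∈ J then rate j else 1)
    (fun j => by
      by_cases hjJ : j ∈ J
      · rw [if_pos hjJ]; exact (hrate0 j hjJ).le
      · rw [if_neg hjJ]; exact zero_le_one) K'
    (fun j h hj hh => by
      have h1 := hrel j h hj hh
      have e : Real.exp ((if j ∈ J then Real.log (rate j) else 0) - 0) = if j ∈ J then rate j else 1 := by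
        rw [sub_zero]
        by_cases hjJ : j ∈ J
        · rw [if_pos hjJ, if_pos hjJ, Real.exp_log (hrate0 j hjJ)]
        · rw [if_neg hjJ, if_neg hjJ, Real.exp_zero]
      rw [e] at h1
      exact h1)
  rw [lawOfRecord_zero] at key
  rw [Finset.prod_filter]
  exact key

/-- **«LCS-0» OF RECORD IS A THEOREM** (g2's `N20LCSAtRecordLevelZero.lcs_rhoZeroOfRecord` read on the label tower): for `ρ₀ = rhoZeroOfRecord g₀ E₀`,
`g₀⁻² ≥ 4N`, the state of the EMPTY history (`eterm ρ₀ 0 h = ρ₀`, `μ_0 =` Haar) has local exponential plaquette moments with `β₀ = g₀⁻²`, `a₀ = 1∕12` and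
g2's constant — so in `halves_labelTower_pinnedLevels` ∕ `sum_admS_integral_le_labelTower_pinnedLevels` a pinned level `0 ∈ J` carries NO hypothesis beyond
the choice `β 0 = g₀⁻²`, `a₀ 0 = 1∕12`, `C 0 =` g2's constant. [folklore] -/
theorem lcs_zero_labelTower_of_record :
    ∃ C : ℝ, 0 ≤ C ∧ ∀ (g₀ E₀ : ℝ), 4 * N ≤ g₀⁻¹ ^ 2 → ∀ (A₁ : ℝ) (ζ : ZetaOfRecord F N ν M) (h : Fin 0 → LabelPat F ν p g)
      (a : ℝ), 0 ≤ a → a ≤ 1 / 12 → ∀ X : Finset (Plaq (F.P p.K) 0),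
        ∫ U, Real.exp (a * g₀⁻¹ ^ 2 * ∑ q ∈ X, (1 - reTr (GaugeField.plaqHol U q))) *
            (labelTowerOfRecord F N ν M p g A₁ ζ).eterm (rhoZeroOfRecord F N p.K g₀ E₀) 0 h U ∂(lawOfRecord F N p.K 0) ≤
          Real.exp (C * a * X.card) *
            ∫ U, (labelTowerOfRecord F N ν M p g A₁ ζ).eterm (rhoZeroOfRecord F N p.K g₀ E₀) 0 h U ∂(lawOfRecord F N p.K 0) := by
  obtain ⟨C, hC, hlcs⟩ := lcs_rhoZeroOfRecord F N
  refine ⟨C, hC, fun g₀ E₀ hg A₁ ζ h a ha ha' X => ?_⟩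
  rw [lawOfRecord_zero]
  exact (hlcs p.K g₀ E₀ hg a ha ha' X).2

open Classical in
/-- **SANITY (the bound of §3 with no pinned level is ATTAINED)**: for the FREE pattern (`E j h =` all level-`j` labels, every `j`) the pattern class is the
whole of `adm K′` and its weight IS the total mass `∫ρ₀ dU₀` (module 28's `sum_adm_integral_eterm_labelTower`) — so `sum_admS_integral_le_labelTower_pinnedLevels`
at `J = ∅` (empty product `= 1`) holds with equality: the currency is not vacuous. [folklore] -/
theorem sum_admS_integral_free_eq (A₁ : ℝ) (hζu : IsZetaUnity F N ν M ζ) (hζ : IsZetaAbsLeOne F N ν M ζ)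
    (hω : ∀ (k : ℕ) (s : SeqOfRecord F ν M g p.K k) (t : LbOfRecord F ν p g k),
      Measurable fun z : cfgOfRecord F N p.K (k + 1) × cfgOfRecord F N p.K k => ωOfRecord F N ν M p g k A₁ ζ s t z.2 z.1)
    {ρ₀ : cfgOfRecord F N p.K 0 → ℝ} (hρ : (bddMeas (cfgOfRecord F N p.K 0)).Gd ρ₀) (K' : ℕ) :
    ∑ h ∈ admS (labelTowerOfRecord F N ν M p g A₁ ζ) (labelPattern F ν p g fun j _ => (Finset.univ : Finset (LbOfRecord F ν p g j))) K',
        ∫ x, (labelTowerOfRecord F N ν M p g A₁ ζ).eterm ρ₀ K' h x ∂(lawOfRecord F N p.K K') =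
      ∫ U, ρ₀ U ∂(fieldMeasure (F.P p.K) 0 (SU N)) := by
  rw [admS_eq_adm_of_forall (T := labelTowerOfRecord F N ν M p g A₁ ζ)
    (S := labelPattern F ν p g fun j _ => (Finset.univ : Finset (LbOfRecord F ν p g j))) (fun j h => by rw [branch_eq, labelPattern]) K']
  exact N20LCSLabelTowerClassWeight.sum_adm_integral_eterm_labelTower F N ν M p g A₁ hζu hζ hω hρ K'

end ClassWeight

end Summit.QuantumFields.YangMills.BalabanUVNodes.N20LCSLabelTowerPinnedLevels

end
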